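import Literature.NumberTheory.ComplexMultiplication.CMTypeUniformizationMultiplicationsRational
import Literature.NumberTheory.ComplexMultiplication.ShimuraTaniyamaDegOneCotangentVanishing
import HarnessLib

/-!
# The reduced `𝔮`-multiplication has zero differential: `δλ̃ = 0` (Shimura 1998, §13.1 proof of Thm. 1, p. 98;
# §18.6 proof of Thm. 18.6, p. 129) — the node `stub_tangentKill` of the degree-one Shimura–Taniyama congruence

Topic `Literature/NumberTheory/ComplexMultiplication`, namespace `Literature.NumberTheory.ComplexMultiplication`.
THEOREMS ONLY (no definition, no named fact, no instance; net Literature debt 0).  Cell `hodgecm-mathlib` (D-0151),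
E2 line for the fan-B row F-S2₁′ `shimuraTaniyamaPair_degOne'` ([Shimura1998] §13.1 Thm. 1 (i) at `N𝔭 = p`,
`p ∤ d(K)`): this file CLOSES the registered stub `stub_tangentKill` of the h21 skeleton `a2_casselman_descent` v12′
(= the T-node of A-p02's assembly `shimuraTaniyamaPair_degOne'_holds`), with the stub's binder telescope VERBATIM.

THE PRINT.  [Shimura1998] §13.1, proof of Thm. 1 (p. 98): for `α ∈ 𝔮 = g(𝔭)` every `φ ∈ Φ` has `φ(α) ≡ 0`
modulo the prime over `𝔭`, so on the space of invariant differential forms of the reduction `δι̃(α) = 0`; «hence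
`δλ̃ = 0`» for the `𝔮`-multiplication `λ` (the print passes through `μ ∘ λ = ι(α)`; here μ-free:
`λ = Σᵢ ι(αᵢ) ∘ λ_{γᵢ}`, `αᵢ ∈ 𝔮`).  §18.6 p. 129 applies this at `p = N(𝔭)` to get «an isomorphism `ψ : Ã_i → Ã^f`
such that `ψ ∘ λ̃ = π`».

THE PROOF (all inputs are theorems of the tree):
* P1 — `cotangentMap_redEnd_eq_zero_of_mem_reflexNorm` (`ShimuraTaniyamaDegOneCotangentVanishing`): for `α ∈ 𝔮`
  the reduced endomorphism `R.redEnd (ιA α)` is ZERO on the cotangent space `𝔪_e/𝔪_e²` of `Ā` (one monic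
  polynomial over `𝓞_{k,𝔓}` carries both characteristic polynomials; the generic one is `∏_{φ∈Φ}(X − φ α)` with
  non-leading coefficients in `𝔭`; so the special one is `X^g`, and «nilpotent ⇒ zero» because `p ∤ d(K)`);
* top — `CMTypeUniformization.forall_tangent_comp_redHom_eq_one_of_forall_cotangentMap_eq_zero`
  (`CMTypeUniformizationMultiplicationsRational`): `λ ∈ ⟨ι_A(𝔮) ≫ Hom_k(A, B)⟩`, the homomorphisms killing the
  tangent vectors at the origin form a two-sided ideal stable under reduction, and the cotangent ⇄ tangent-vector
  dictionary.

* `shimuraTaniyamaDegOne_tangentKill` — the stub text: `λ̃ = H.redHom λ` kills every `κ(Ã)[ε]`-point of `Ā` at the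
  origin.  (The binder `hq : N𝔭 = p` of the stub is not used by this node — it is consumed by `stub_degree`.)

HC_CM is proved only modulo the 7 printed citations until rung 0 closes; this file discharges one registered node of
the E2 split of F-S2₁′, a banked edition (no floor change by itself).

## References
* [Shimura1998] G. Shimura, *Abelian Varieties with Complex Multiplication and Modular Functions* (1998), §13.1
  proof of Thm. 1 (p. 98); §13.2 (pp. 99–100); §18.6 proof of Thm. 18.6 (pp. 128–129); §2.8 Prop. 6 (p. 16).
* [GortzWedhorn2023] U. Görtz, T. Wedhorn, *Algebraic Geometry II*, Rem. 27.18 (1)–(4).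
-/

set_option autoImplicit false

noncomputable section

open CategoryTheory IsDedekindDomain NumberField AlgebraicGeometry TrivSqZeroExt
open scoped NumberField nonZeroDivisors MonObj

namespace Literature.NumberTheory.ComplexMultiplication

open Literature.AlgebraicGeometry.Motives
open Literature.AlgebraicGeometry.Motives.AbelianVariety
open Literature.AlgebraicGeometry.Motives.AlgPoints

/-- **`δλ̃ = 0` for the reduced `𝔮`-multiplication** ([Shimura1998] §13.1 proof of Thm. 1, p. 98, «hence `δλ̃ = 0`»;
§18.6 p. 129) — the registered stub `stub_tangentKill` of the E2 split of `shimuraTaniyamaPair_degOne'`, binders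
verbatim: for `(A, ιA)`, `(B, ιB)` of types `(K, Φ, 𝔞)`, `(K, Φ, 𝔟)` over the number field `k ⊇ K*` with
`k`-shape uniformisations `ξ`, `ηB`, `𝔮 𝔟 = 𝔞`, the `𝔮`-multiplication `λ` (`λ(ξ.r u) = ηB.r u`), a prime `𝔭` of `K*`
with `𝔓 ∣ 𝔭` in `k`, residue characteristic `p ∤ d(K)`, `𝔮 = g(𝔭)` the reflex type norm, and bare reduction data
`R`, `S`, `H` at `𝔓`: the reduction `λ̃ = H.redHom λ` kills every `κ(Ã)[ε]`-valued tangent vector of `Ā` at the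
origin.  Proof: P1 (`cotangentMap_redEnd_eq_zero_of_mem_reflexNorm`: `δι̃(α) = 0` on `𝔪_e/𝔪_e²` for `α ∈ 𝔮`) fed
into the μ-free top `CMTypeUniformization.forall_tangent_comp_redHom_eq_one_of_forall_cotangentMap_eq_zero`.
[cite: Shimura1998, §13.1 proof of Thm. 1 (p. 98); §18.6 proof of Thm. 18.6 (p. 129); §2.8 Prop. 6 (p. 16)]
[cite: GortzWedhorn2023, Rem. 27.18 (1) and (4)] -/
theorem shimuraTaniyamaDegOne_tangentKill (K : Type) [Field K] [NumberField K] [IsCMField K] (Φ : CMType K)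
    [NumberField (traceField Φ)]
    (k : Type) [Field k] [NumberField k] [Algebra k ℂ] (i₀ : traceField Φ →+* k)
    (hi₀ : (algebraMap k ℂ).comp i₀ = algebraMap (traceField Φ) ℂ)
    (𝔞 𝔟 : (FractionalIdeal (𝓞 K)⁰ K)ˣ) (𝔮 : Ideal (𝓞 K))
    (h𝔮𝔟 : (𝔮 : FractionalIdeal (𝓞 K)⁰ K) * (𝔟 : FractionalIdeal (𝓞 K)⁰ K) = 𝔞)
    (A B : AbelianVariety k) (ιA : 𝓞 K →+* End A) (ιB : 𝓞 K →+* End B)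
    (ξ : CMTypeUniformization Φ 𝔞 A ιA) (ηB : CMTypeUniformization Φ 𝔟 B ιB)
    (lam : A ⟶ B) (hlam : ∀ u : K, AlgPoints.map lam.hom.hom.hom (ξ.r u) = ηB.r u)
    (𝔭 : HeightOneSpectrum (𝓞 (traceField Φ))) (𝔓 : HeightOneSpectrum (𝓞 k))
    (h𝔓 : 𝔓.asIdeal.comap (RingOfIntegers.mapRingHom i₀) = 𝔭.asIdeal)
    (p : ℕ) [ExpChar 𝔓.asIdeal.ResidueField p] (_hq : Ideal.absNorm 𝔭.asIdeal = p ^ 1)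
    (hdisc : ¬ ((p : ℤ) ∣ NumberField.discr K))
    (h𝔮 : ∃ (Lg : Type) (_ : Field Lg) (_ : NumberField Lg) (_ : Normal ℚ Lg) (ιL : Lg →+* ℂ)
        (j : K →+* Lg) (σ₀ : traceField Φ →+* Lg),
        ιL.comp σ₀ = algebraMap (traceField Φ) ℂ ∧ IsReflexTypeNorm (valuedIn ιL Φ.1) j σ₀ 𝔭.asIdeal 𝔮)
    (R : A.GoodReductionAt 𝔓) (S : B.GoodReductionAt 𝔓) (H : GoodReductionAt.HomReduction R S) :
    ∀ t : specOver 𝔓.asIdeal.ResidueField (DualNumber R.reduction.X.left.functionField) ⟶ R.reduction.X,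
      specOverMapOfAlgHom (fstHom 𝔓.asIdeal.ResidueField R.reduction.X.left.functionField
          R.reduction.X.left.functionField) ≫ t = 1 →
        t ≫ (H.redHom lam).hom.hom.hom = 1 :=
  fun t ht ↦ CMTypeUniformization.forall_tangent_comp_redHom_eq_one_of_forall_cotangentMap_eq_zero ξ ηB 𝔮 h𝔮𝔟
    hlam H
    (fun α hα ↦ cotangentMap_redEnd_eq_zero_of_mem_reflexNorm K Φ k i₀ hi₀ 𝔞 A ιA ξ 𝔭 𝔓 h𝔓 p hdisc 𝔮 h𝔮 R α hα)
    R.reduction.X.left.functionField t ht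

/-- **`δλ̃ = 0` at EVERY field `L ⊇ κ(𝔓)`** (same node, `L[ε]`-valued tangent vectors for any `L`; the registered
stub is the case `L = κ(Ã)`). [cite: Shimura1998, §13.1 proof of Thm. 1 (p. 98); §18.6 proof of Thm. 18.6 (p. 129)]
[cite: GortzWedhorn2023, Rem. 27.18 (1) and (4)] -/
theorem shimuraTaniyamaDegOne_tangentKill' (K : Type) [Field K] [NumberField K] [IsCMField K] (Φ : CMType K)
    [NumberField (traceField Φ)]
    (k : Type) [Field k] [NumberField k] [Algebra k ℂ] (i₀ : traceField Φ →+* k)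
    (hi₀ : (algebraMap k ℂ).comp i₀ = algebraMap (traceField Φ) ℂ)
    (𝔞 𝔟 : (FractionalIdeal (𝓞 K)⁰ K)ˣ) (𝔮 : Ideal (𝓞 K))
    (h𝔮𝔟 : (𝔮 : FractionalIdeal (𝓞 K)⁰ K) * (𝔟 : FractionalIdeal (𝓞 K)⁰ K) = 𝔞)
    (A B : AbelianVariety k) (ιA : 𝓞 K →+* End A) (ιB : 𝓞 K →+* End B)
    (ξ : CMTypeUniformization Φ 𝔞 A ιA) (ηB : CMTypeUniformization Φ 𝔟 B ιB)
    (lam : A ⟶ B) (hlam : ∀ u : K, AlgPoints.map lam.hom.hom.hom (ξ.r u) = ηB.r u)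
    (𝔭 : HeightOneSpectrum (𝓞 (traceField Φ))) (𝔓 : HeightOneSpectrum (𝓞 k))
    (h𝔓 : 𝔓.asIdeal.comap (RingOfIntegers.mapRingHom i₀) = 𝔭.asIdeal)
    (p : ℕ) [ExpChar 𝔓.asIdeal.ResidueField p]
    (hdisc : ¬ ((p : ℤ) ∣ NumberField.discr K))
    (h𝔮 : ∃ (Lg : Type) (_ : Field Lg) (_ : NumberField Lg) (_ : Normal ℚ Lg) (ιL : Lg →+* ℂ)
        (j : K →+* Lg) (σ₀ : traceField Φ →+* Lg),
        ιL.comp σ₀ = algebraMap (traceField Φ) ℂ ∧ IsReflexTypeNorm (valuedIn ιL Φ.1) j σ₀ 𝔭.asIdeal 𝔮)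
    (R : A.GoodReductionAt 𝔓) (S : B.GoodReductionAt 𝔓) (H : GoodReductionAt.HomReduction R S)
    (L : Type) [Field L] [Algebra 𝔓.asIdeal.ResidueField L]
    (t : specOver 𝔓.asIdeal.ResidueField (DualNumber L) ⟶ R.reduction.X)
    (ht : specOverMapOfAlgHom (fstHom 𝔓.asIdeal.ResidueField L L) ≫ t = 1) :
    t ≫ (H.redHom lam).hom.hom.hom = 1 :=
  CMTypeUniformization.forall_tangent_comp_redHom_eq_one_of_forall_cotangentMap_eq_zero ξ ηB 𝔮 h𝔮𝔟 hlam H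
    (fun α hα ↦ cotangentMap_redEnd_eq_zero_of_mem_reflexNorm K Φ k i₀ hi₀ 𝔞 A ιA ξ 𝔭 𝔓 h𝔓 p hdisc 𝔮 h𝔮 R α hα)
    L t ht

end Literature.NumberTheory.ComplexMultiplication

end
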